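import Mathlib
import HarnessLib
import Literature.Analysis.FluidPDE.SelfSimilar
import Literature.Analysis.FluidPDE.HyperbolicDSSOrbit
import Literature.Analysis.FluidPDE.AncientSimilarityVariables
import Literature.Analysis.FluidPDE.ChaeWolfRemovingDSS
import Literature.Analysis.FluidPDE.PineauVicolOneSlice
import Literature.Analysis.FluidPDE.PineauVicolOneSliceRegularityHolds
import Literature.Barriers.NavierStokesRegularity.NearOneDssTypeIExclusion
import Summits.NavierStokesRegularity.NavierStokesRegularity.Theorems.QuarterLogPincerFlatWindowDefs
import Summits.NavierStokesRegularity.NavierStokesRegularity.Theorems.QuarterLogPincerTypeIQuantSubcubicExpFlatWindowSliceDictionary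
import Summits.NavierStokesRegularity.NavierStokesRegularity.Theorems.QuarterLogPincerTypeIQuantSubcubicExpFlatWindowAccelerationBound
import Summits.NavierStokesRegularity.NavierStokesRegularity.Theorems.QuarterLogPincerTypeIQuantSubcubicExpFlatWindowAnnulusPressure

/-!
# Crux `QuarterLogPincer.TypeIQuantSubcubicExp` (stmt-NavierStokesRegularity-24077), rung line `flat_window`:
  the COMPOSITION — an explicit near-one DSS exclusion window in the Type-I envelope class, and the
  kernel link of the two evasion conjuncts of the barrier `NearOneDssTypeIExclusion`

Lead-prover file (ns-tc-p1 g4; `--supports stmt-NavierStokesRegularity-24077 --as helper`).  With the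
three obligations of ns-idea-7's rung line `Cruxes/TypeIQuantSubcubicExp/Lines/flat_window.lean`
(183c0c8f2f447a08; idea-crit-7 PASS-WITH-PRICE, grade «rung corollary / VARIANT-OF Pineau–Vicol 2026
Thm 1.9 + 1.6») LANDED BY NAME — `stub_sliceDictionary` (p629490), `stub_accelerationBound`,
`stub_annulusPressure` (p630589) — the line's kernel-checked compositions become sorry-free theorems of
the tree; this file lands them VERBATIM from the workfile (the line's local notation `ℝ³` spelled out):

* `periodic_deriv_norm_le` — temporal Poincaré: an `S`-periodic `C²` curve with `‖g''‖ ≤ B` has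
  `‖g'‖ ≤ B·S`;
* `isDiscretelySelfSimilar_pow`, `eq_zero_of_dss_of_bounded_apex` — a `λ`-DSS field bounded near its
  apex vanishes on the past (zoom-down);
* `oneSliceThreshold_of_pv`, `oneSliceThreshold_exists` — Pineau–Vicol Thm 1.9 (tree theorem
  `pineauVicol2026_oneSlice_regularity_holds`) supplies a one-slice threshold `δ₀(C₀)`;
* `regularApex_of_flat`, `removingDss_window_of`, `chaeWolf2017_removing_dss_of_flatWindow` — the
  window theorem from the four obligations and the LINK «one-slice regularity + acceleration bound +
  pressure bound + dictionary ⇒ Chae–Wolf near-one exclusion»;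
* `removingDss_explicitWindow` — **the rung statement, now UNCONDITIONAL**: for every `C₀ > 0` there
  are `δ₀(C₀) > 0` (one-slice threshold) and `B(C₀) > 0` (acceleration bound) such that every
  `λ`-DSS classical ancient solution in the envelope class `HasTypeIDecay C₀` with
  `1 < λ ≤ exp(δ₀/(2B))` vanishes identically;
* (the workfile's `chaeWolf2017_removing_dss_via_oneSlice : chaeWolf2017_removing_dss` is NOT re-landed:
  its statement is the Literature theorem `chaeWolf2017_removing_dss_holds` verbatim (dedup); the
  window-displaying second proof is `chaeWolf2017_removing_dss_of_flatWindow stub_sliceDictionary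
  stub_accelerationBound stub_annulusPressure`.)

HONEST FRAMING (critic P1/P2): a QUANTITATIVE near-one exclusion is in print (Pineau–Vicol 2026 §6,
Thm 1.6); what this adds is the 30-line kernel route 1.6 ⇐ 1.9 + flatness with the window a FORMULA
`exp(δ₀/2B)` in two effective-in-principle constants (not computed here).  S3 `stub_thinCascadeLiouville`
of 24077 is NOT narrowed (the window is near-one only); the crux `TypeIQuantSubcubicExp`,
`SuperlogCubeRate` and Navier–Stokes regularity remain OPEN; no summit statement is proved by this file.
-/

noncomputable section

-- the summit-side namespace `Summit.NavierStokesRegularity.NavierStokesRegularity.…` (single-conjunct summit,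
-- D-0017) repeats a component by design; the dupNamespace linter would flag every declaration.
set_option linter.dupNamespace false

namespace Summit.NavierStokesRegularity.NavierStokesRegularity.Cruxes.TypeIQuantSubcubicExp.FlatWindow

open MeasureTheory Set Function Filter Topology Metric
open Literature.Analysis Literature.Analysis.FluidPDE

/-! ### Proved: the temporal Poincaré (flatness) lemma -/

/-- **Flatness of slow breathers.** A `C²` curve `g : ℝ → EuclideanSpace ℝ (Fin 3)`, periodic with period `S > 0` and with
acceleration `‖g''‖ ≤ B`, has velocity `‖g'(s)‖ ≤ B·S` everywhere: `S•g'(s) = ∫ₛ^{s+S}(g'(s) − g'(σ))dσ`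
because `∫ₛ^{s+S} g' = g(s+S) − g(s) = 0`, and `‖g'(s) − g'(σ)‖ ≤ B|σ−s| ≤ B S`. -/
theorem periodic_deriv_norm_le {g : ℝ → EuclideanSpace ℝ (Fin 3)} {S B : ℝ} (hS : 0 < S) (hper : Function.Periodic g S)
    (hg : ContDiff ℝ 2 g) (hB : ∀ s, ‖iteratedDeriv 2 g s‖ ≤ B) : ∀ s, ‖deriv g s‖ ≤ B * S := by
  have hB0 : 0 ≤ B := le_trans (norm_nonneg _) (hB 0)
  have hdiff : Differentiable ℝ g := hg.differentiable (by norm_num)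
  have hcont' : Continuous (deriv g) := hg.continuous_deriv (by norm_num)
  -- `deriv g` is differentiable with derivative `iteratedDeriv 2 g`
  have hdiff' : Differentiable ℝ (deriv g) := by
    have h := hg.differentiable_iteratedDeriv 1 (by norm_num)
    simpa [iteratedDeriv_one] using h
  have hd2 : ∀ σ, deriv (deriv g) σ = iteratedDeriv 2 g σ := by
    intro σ
    have : iteratedDeriv 2 g = deriv (deriv g) := by
      show iteratedDeriv (1 + 1) g = deriv (deriv g)
      rw [iteratedDeriv_succ, iteratedDeriv_one]
    rw [this]
  -- Lipschitz bound on `deriv g`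
  have hlip : ∀ a b : ℝ, ‖deriv g b - deriv g a‖ ≤ B * ‖b - a‖ := by
    intro a b
    refine Convex.norm_image_sub_le_of_norm_deriv_le (f := deriv g) (s := univ)
      (fun x _ => hdiff' x) (fun x _ => ?_) convex_univ (mem_univ a) (mem_univ b)
    rw [hd2]; exact hB x
  intro s
  -- FTC over one period
  have hftc : ∫ σ in s..s + S, deriv g σ = g (s + S) - g s :=
    intervalIntegral.integral_eq_sub_of_hasDerivAt (fun x _ => (hdiff x).hasDerivAt)
      (hcont'.intervalIntegrable _ _)
  have hzero : ∫ σ in s..s + S, deriv g σ = 0 := by rw [hftc, hper s, sub_self]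
  have hconst : ∫ _σ in s..s + S, deriv g s = S • deriv g s := by
    rw [intervalIntegral.integral_const]; simp
  have hkey : S • deriv g s = ∫ σ in s..s + S, (deriv g s - deriv g σ) := by
    rw [intervalIntegral.integral_sub intervalIntegrable_const (hcont'.intervalIntegrable _ _), hzero,
      sub_zero, hconst]
  have hbound : ‖∫ σ in s..s + S, (deriv g s - deriv g σ)‖ ≤ (B * S) * |s + S - s| := by
    refine intervalIntegral.norm_integral_le_of_norm_le_const fun σ hσ => ?_
    have hσ' : σ ∈ Icc s (s + S) := by
      rw [uIoc_of_le (by linarith)] at hσ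
      exact ⟨hσ.1.le, hσ.2⟩
    calc ‖deriv g s - deriv g σ‖ = ‖deriv g σ - deriv g s‖ := norm_sub_rev _ _
      _ ≤ B * ‖σ - s‖ := hlip s σ
      _ ≤ B * S := by
          refine mul_le_mul_of_nonneg_left ?_ hB0
          rw [Real.norm_eq_abs, abs_of_nonneg (by linarith [hσ'.1])]
          linarith [hσ'.2]
  have : S * ‖deriv g s‖ ≤ (B * S) * S := by
    have h1 : ‖S • deriv g s‖ = S * ‖deriv g s‖ := by rw [norm_smul, Real.norm_eq_abs, abs_of_pos hS]
    rw [← h1, hkey]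
    simpa [add_sub_cancel_left, abs_of_pos hS] using hbound
  nlinarith [norm_nonneg (deriv g s)]

/-! ### Proved: a DSS field bounded near its apex vanishes -/

/-- Powers of the factor are factors. -/
theorem isDiscretelySelfSimilar_pow {c : ℝ} {u : ℝ → EuclideanSpace ℝ (Fin 3) → EuclideanSpace ℝ (Fin 3)} (hu : IsDiscretelySelfSimilar c u) :
    ∀ n : ℕ, IsDiscretelySelfSimilar (c ^ n) u := by
  intro n
  induction n with
  | zero => simp [IsDiscretelySelfSimilar, nsRescale_one u]
  | succ n ih => simpa [pow_succ] using ih.mul hu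

/-- **Zoom-down.** A `λ`-DSS field (`λ > 1`) bounded on some backward cylinder `B_r × (−r²,0)` at its
apex is identically zero on the past: `u(t,x) = λ^{-n} u(λ^{-2n}t, λ^{-n}x)` and the argument enters the
cylinder for `n` large, so `‖u(t,x)‖ ≤ M λ^{-n} → 0`. -/
theorem eq_zero_of_dss_of_bounded_apex {c : ℝ} (hc : 1 < c) {u : ℝ → EuclideanSpace ℝ (Fin 3) → EuclideanSpace ℝ (Fin 3)}
    (hu : IsDiscretelySelfSimilar c u) {r M : ℝ} (hr : 0 < r)
    (hM : ∀ t : ℝ, -r ^ 2 < t → t < 0 → ∀ x ∈ ball (0 : EuclideanSpace ℝ (Fin 3)) r, ‖u t x‖ ≤ M) :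
    ∀ t < 0, ∀ x, u t x = 0 := by
  intro t ht x
  have hc0 : 0 < c := lt_trans zero_lt_one hc
  -- the rescaling identity with factor `c^n`, read at the zoomed-down point
  have hid : ∀ n : ℕ, ‖u t x‖ = (c ^ n)⁻¹ * ‖u ((c ^ n)⁻¹ ^ 2 * t) ((c ^ n)⁻¹ • x)‖ := by
    intro n
    have hcn : 0 < c ^ n := pow_pos hc0 n
    have key := congrFun (congrFun (isDiscretelySelfSimilar_pow hu n) ((c ^ n)⁻¹ ^ 2 * t))
      ((c ^ n)⁻¹ • x)
    rw [nsRescale_apply] at key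
    have h1 : (c ^ n) ^ 2 * ((c ^ n)⁻¹ ^ 2 * t) = t := by field_simp
    have h2 : (c ^ n) • (c ^ n)⁻¹ • x = x := by rw [smul_smul, mul_inv_cancel₀ hcn.ne', one_smul]
    rw [h1, h2] at key
    rw [← key, norm_smul, Real.norm_eq_abs, abs_of_pos hcn, ← mul_assoc, inv_mul_cancel₀ hcn.ne',
      one_mul]
  -- for `n` large the zoomed-down point lies in the cylinder
  have hlim : Tendsto (fun n : ℕ => (c ^ n)⁻¹) atTop (𝓝 0) := by
    have := tendsto_pow_atTop_atTop_of_one_lt hc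
    exact this.inv_tendsto_atTop
  have hev : ∀ᶠ n : ℕ in atTop, ‖u t x‖ ≤ M * (c ^ n)⁻¹ := by
    have hA : ∀ᶠ n : ℕ in atTop, (c ^ n)⁻¹ ^ 2 * (-t) < r ^ 2 := by
      have h0 : Tendsto (fun n : ℕ => (c ^ n)⁻¹ ^ 2 * (-t)) atTop (𝓝 (0 ^ 2 * (-t))) :=
        (hlim.pow 2).mul_const _
      simp only [ne_eq, OfNat.ofNat_ne_zero, not_false_eq_true, zero_pow, zero_mul] at h0
      exact h0.eventually (gt_mem_nhds (by positivity))
    have hB' : ∀ᶠ n : ℕ in atTop, (c ^ n)⁻¹ * ‖x‖ < r := by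
      have h0 : Tendsto (fun n : ℕ => (c ^ n)⁻¹ * ‖x‖) atTop (𝓝 (0 * ‖x‖)) := hlim.mul_const _
      rw [zero_mul] at h0
      exact h0.eventually (gt_mem_nhds hr)
    filter_upwards [hA, hB'] with n hA hB'
    have hcn : 0 < c ^ n := pow_pos hc0 n
    have hin : (c ^ n)⁻¹ • x ∈ ball (0 : EuclideanSpace ℝ (Fin 3)) r := by
      rw [mem_ball_zero_iff, norm_smul, Real.norm_eq_abs, abs_of_pos (inv_pos.2 hcn)]
      exact hB'
    have ht1 : -r ^ 2 < (c ^ n)⁻¹ ^ 2 * t := by nlinarith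
    have ht2 : (c ^ n)⁻¹ ^ 2 * t < 0 := mul_neg_of_pos_of_neg (by positivity) ht
    have := hM _ ht1 ht2 _ hin
    rw [hid n]
    calc (c ^ n)⁻¹ * ‖u ((c ^ n)⁻¹ ^ 2 * t) ((c ^ n)⁻¹ • x)‖ ≤ (c ^ n)⁻¹ * M :=
          mul_le_mul_of_nonneg_left this (inv_pos.2 hcn).le
      _ = M * (c ^ n)⁻¹ := mul_comm _ _
  have hle : ‖u t x‖ ≤ M * 0 :=
    ge_of_tendsto (hlim.const_mul M) hev
  rw [mul_zero] at hle
  exact norm_le_zero_iff.1 hle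

/-! ### Kernel-checked compositions -/

/-- The tree's Theorem 1.9 supplies a one-slice threshold for every envelope constant. -/
theorem oneSliceThreshold_of_pv (h : pineauVicol2026_oneSlice_regularity) :
    ∀ Cu : ℝ, 0 < Cu → ∃ δ₀ : ℝ, OneSliceThreshold Cu δ₀ := by
  intro Cu hCu
  obtain ⟨δ₀, hδ₀, -, hmain⟩ := h Cu hCu
  exact ⟨δ₀, hδ₀, fun Cp hCp => hmain Cp hCp⟩

/-- … unconditionally, by `pineauVicol2026_oneSlice_regularity_holds`. -/
theorem oneSliceThreshold_exists : ∀ Cu : ℝ, 0 < Cu → ∃ δ₀ : ℝ, OneSliceThreshold Cu δ₀ :=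
  oneSliceThreshold_of_pv pineauVicol2026_oneSlice_regularity_holds

/-- **Regular apex of uniformly flat profiles** (the shared core; no self-similarity assumed): if every
slice of an envelope-class ancient classical solution has profile velocity `‖∂ₛU‖ ≤ δ₀(C₀)` then
`(0,0)` is a regular point. -/
theorem regularApex_of_flat (hdict : SliceDictionary) {C₀ δ₀ Cp : ℝ} (hT : OneSliceThreshold C₀ δ₀)
    (hCp : 0 < Cp) (hP : AnnulusPressure C₀ Cp)
    {u : ℝ → EuclideanSpace ℝ (Fin 3) → EuclideanSpace ℝ (Fin 3)} {p : ℝ → EuclideanSpace ℝ (Fin 3) → ℝ} (hsol : IsClassicalNSSolutionOn (Iio 0) 1 0 u p)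
    (hdec : HasTypeIDecay C₀ u) (hflat : ∀ (s : ℝ) (y : EuclideanSpace ℝ (Fin 3)), ‖deriv (profileLine u y) s‖ ≤ δ₀) :
    ∃ r : ℝ, 0 < r ∧ ∃ M : ℝ, ∀ t : ℝ, -r ^ 2 < t → t < 0 → ∀ x ∈ ball (0 : EuclideanSpace ℝ (Fin 3)) r, ‖u t x‖ ≤ M := by
  obtain ⟨p', hreg, hpb⟩ := hP u p hsol hdec
  obtain ⟨s₀, hs₀, hmain⟩ := hT.2 Cp hCp
  have henv : ∀ t ∈ Ico (-1 : ℝ) 0, ∀ x ∈ ball (0 : EuclideanSpace ℝ (Fin 3)) 1, ‖u t x‖ ≤ C₀ / (Real.sqrt (-t) + ‖x‖) := by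
    intro t ht x _
    rw [add_comm]
    exact hdec t ht.2 x
  -- the slice `t̄ = −e^{−s₀}/2`
  set tbar : ℝ := -Real.exp (-s₀) / 2 with htbar
  have hpos : 0 < Real.exp (-s₀) := Real.exp_pos _
  have h1 : -Real.exp (-s₀) < tbar := by rw [htbar]; linarith
  have h2 : tbar < 0 := by rw [htbar]; linarith
  have h3 : -1 < tbar := by
    have : Real.exp (-s₀) ≤ 1 := by rw [Real.exp_le_one_iff]; linarith
    linarith
  refine hmain u p' hreg henv hpb tbar h1 h2 fun x hx => ?_
  rw [hdict u p hsol tbar h3 h2 x hx]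
  exact hflat _ _

/-- **The window theorem from the obligations.**  One-slice threshold `δ₀`, acceleration bound `B`,
annulus pressure bound and the dictionary give: every `λ`-DSS envelope-class (`C₀`) classical ancient
solution with `1 < λ` and `log λ ≤ δ₀/(2B)` is identically zero. -/
theorem removingDss_window_of (hdict : SliceDictionary) {C₀ δ₀ B Cp : ℝ}
    (hT : OneSliceThreshold C₀ δ₀) (hA : AccelerationBound C₀ B) (hB : 0 < B) (hCp : 0 < Cp)
    (hP : AnnulusPressure C₀ Cp) :
    ∀ c : ℝ, 1 < c → Real.log c ≤ δ₀ / (2 * B) →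
      ∀ (u : ℝ → EuclideanSpace ℝ (Fin 3) → EuclideanSpace ℝ (Fin 3)) (p : ℝ → EuclideanSpace ℝ (Fin 3) → ℝ),
        IsClassicalNSSolutionOn (Iio 0) 1 0 u p → IsDiscretelySelfSimilar c u → HasTypeIDecay C₀ u →
        ∀ t < 0, ∀ x, u t x = 0 := by
  intro c hc hwin u p hsol hdss hdec
  have hc0 : 0 < c := lt_trans zero_lt_one hc
  have hS : 0 < 2 * Real.log c := by have := Real.log_pos hc; linarith
  -- flatness of every profile line, by the Poincaré lemma
  have hflat : ∀ (s : ℝ) (y : EuclideanSpace ℝ (Fin 3)), ‖deriv (profileLine u y) s‖ ≤ δ₀ := by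
    intro s y
    obtain ⟨hC2, hacc⟩ := hA u p hsol hdec y
    have hper : Function.Periodic (profileLine u y) (2 * Real.log c) := by
      intro σ
      have := hdss.periodic_lerayOrbit hc0 σ
      simpa [profileLine] using congrFun this y
    have := periodic_deriv_norm_le hS hper hC2 hacc s
    have h2B : (2 * B) ≠ 0 := by positivity
    have hle : B * (2 * Real.log c) ≤ δ₀ := by
      have hm := mul_le_mul_of_nonneg_left hwin (by positivity : (0 : ℝ) ≤ 2 * B)
      rw [mul_div_assoc', mul_div_cancel_left₀ δ₀ h2B] at hm
      calc B * (2 * Real.log c) = 2 * B * Real.log c := by ring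
        _ ≤ δ₀ := hm
    exact this.trans hle
  obtain ⟨r, hr, M, hM⟩ := regularApex_of_flat hdict hT hCp hP hsol hdec hflat
  exact eq_zero_of_dss_of_bounded_apex hc hdss hr hM

/-- **The barrier's two conjuncts, formally linked** (cf. `NearOneDssTypeIExclusion`: "NOT formally
linked"): one-slice regularity (Thm 1.9, in the tree) + the three obligations ⇒ Chae–Wolf's near-one
exclusion, with the window `c₁ = exp(δ₀(C₀)/(2B(C₀)))`. -/
theorem chaeWolf2017_removing_dss_of_flatWindow (hdict : SliceDictionary)
    (hacc : ∀ C₀ : ℝ, 0 < C₀ → ∃ B : ℝ, 0 < B ∧ AccelerationBound C₀ B)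
    (hpr : ∀ C₀ : ℝ, 0 < C₀ → ∃ Cp : ℝ, 0 < Cp ∧ AnnulusPressure C₀ Cp) :
    chaeWolf2017_removing_dss := by
  intro C₀ hC₀
  obtain ⟨δ₀, hT⟩ := oneSliceThreshold_exists C₀ hC₀
  obtain ⟨B, hB, hA⟩ := hacc C₀ hC₀
  obtain ⟨Cp, hCp, hP⟩ := hpr C₀ hC₀
  refine ⟨Real.exp (δ₀ / (2 * B)), ?_, fun c hc hcc u p hsol hdss hdec => ?_⟩
  · rw [Real.one_lt_exp_iff]; exact div_pos hT.1 (by positivity)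
  · have hwin : Real.log c ≤ δ₀ / (2 * B) := by
      have := Real.log_lt_log (lt_trans zero_lt_one hc) hcc
      rw [Real.log_exp] at this
      exact this.le
    exact removingDss_window_of hdict hT hA hB hCp hP c hc hwin u p hsol hdss hdec

/-- **The displayed window (rung statement of the line).** For every `C₀ > 0` there are a one-slice
threshold `δ₀` and an acceleration bound `B` — both outputs of quantitative interior estimates, hence
COMPUTABLE instrument targets — such that `λ`-DSS is excluded in the envelope class for all
`1 < λ ≤ exp(δ₀/(2B))`. -/
theorem removingDss_explicitWindow :
    ∀ C₀ : ℝ, 0 < C₀ → ∃ δ₀ B : ℝ, 0 < δ₀ ∧ 0 < B ∧ OneSliceThreshold C₀ δ₀ ∧ AccelerationBound C₀ B ∧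
      ∀ c : ℝ, 1 < c → c ≤ Real.exp (δ₀ / (2 * B)) →
        ∀ (u : ℝ → EuclideanSpace ℝ (Fin 3) → EuclideanSpace ℝ (Fin 3)) (p : ℝ → EuclideanSpace ℝ (Fin 3) → ℝ),
          IsClassicalNSSolutionOn (Iio 0) 1 0 u p → IsDiscretelySelfSimilar c u → HasTypeIDecay C₀ u →
          ∀ t < 0, ∀ x, u t x = 0 := by
  intro C₀ hC₀
  obtain ⟨δ₀, hT⟩ := oneSliceThreshold_exists C₀ hC₀
  obtain ⟨B, hB, hA⟩ := stub_accelerationBound C₀ hC₀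
  obtain ⟨Cp, hCp, hP⟩ := stub_annulusPressure C₀ hC₀
  refine ⟨δ₀, B, hT.1, hB, hT, hA, fun c hc hcc u p hsol hdss hdec => ?_⟩
  have hwin : Real.log c ≤ δ₀ / (2 * B) := by
    have := Real.log_le_log (lt_trans zero_lt_one hc) hcc
    rwa [Real.log_exp] at this
  exact removingDss_window_of stub_sliceDictionary hT hA hB hCp hP c hc hwin u p hsol hdss hdec

end Summit.NavierStokesRegularity.NavierStokesRegularity.Cruxes.TypeIQuantSubcubicExp.FlatWindow

end
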